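import Literature.Barriers.RiemannHypothesis.EpsteinZetaRealZerosDHVocabulary
import Mathlib.NumberTheory.NumberField.Discriminant.Basic
import HarnessLib

/-!
# Davenport–Heilbronn for Epstein zeta functions, IV: the genus twist of Davenport–Heilbronn I §4
# (real class-group character), its values on prime ideals, and the conjugation symmetry

Sibling of `Literature/Barriers/RiemannHypothesis/EpsteinZetaRealZeros.lean` (named fact
`DavenportHeilbronn1936b_epstein`). Everything in this file is PROVED; no definitions, no named facts.

Davenport–Heilbronn I, §4 (the case `h(d)` EVEN): "Since the order of the class-group is even,
there exists a real non-principal character `χ₁`. […] The proof is identical with that of §2 [§2: for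
any prime `p`, we define `a(p) = 1` if `χ₁(p) = 0` or `1`, `a(p) = i` if `χ₁(p) = −1`; and, for
`n = p₁^{ν₁} ⋯ p_r^{ν_r}`, `a(n) = a(p₁)^{ν₁} ⋯ a(p_r)^{ν_r}`], except for one point in connection with
the application of Kronecker's theorem. The numbers `N𝔭` are not all different, but the same `N𝔭`
can arise only from two different `𝔭`'s, and the product `𝔭₁𝔭₂` of two such `𝔭`'s is a rational
prime. Hence `χ₁(𝔭₁)χ₁(𝔭₂) = 1`, i.e. `a(𝔭₁) = a(𝔭₂)`."

Here, for a QUADRATIC field `K` (`[K : ℚ] = 2`), a real character `χ₁` of `Cl(K)` (`χ₁ = ±1`) and a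
completely multiplicative `a : ℕ →* ℂ` with the printed prime values
`a(p) = i` if `χ₁([𝔭]) = −1` for SOME prime `𝔭` of norm `p`, `a(p) = 1` otherwise (hypothesis
`IsDHGenusTwist`, stated on `a`; the sibling assembly builds `a` with the tree's `complMul`), we prove:

* prime ideals of a quadratic field (`absNorm_eq_or_eq_sq`, `asIdeal_eq_span_of_absNorm_eq_sq`,
  `mul_eq_span_of_absNorm_eq`): `N𝔭 ∈ {p, p²}`; `N𝔭 = p²` forces `𝔭 = (p)` (principal); two
  distinct primes of norm `p` have product `(p)` — the printed "the same `N𝔭` can arise only from two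
  different `𝔭`'s, and the product `𝔭₁𝔭₂` … is a rational prime";
* `IsDHGenusTwist.apply_eq_I_iff` — consequently `a(p) = i ↔ χ₁([𝔭]) = −1` for EVERY prime `𝔭` of
  norm `p` (well-definedness, "`a(𝔭₁) = a(𝔭₂)`"), and on degree-one primes
  `a(N𝔭) = ½(1+i) + ½(1−i)χ₁([𝔭])` (`apply_absNorm_eq_of_prime`, the identity behind Lemma 1 of §2:
  "`∑_p α(p)χ(p)p^{-s} = ½(1+i)∑_p χ(p)p^{-s} + ½(1−i)∑_p χ(p)χ₁(p)p^{-s}`");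
* `IsDHGenusTwist.conj_apply_absNorm` — `conj a(N𝔭) = χ₁([𝔭]) a(N𝔭)` for every prime `𝔭`, whence
  `conj ∘ twistCoeff χ a = twistCoeff (χ₁ − χ) a` (`conj_twistCoeff`): the conjugation symmetry which
  makes D–H's `Z(s)` real ("`M(s, χ₀)` and `M(s, χ₁)` are conjugate for real `s`, and `N(s)` is real",
  Titchmarsh §10.25) — in the sibling: `conj Z(s) = χ₁([𝔟]) Z(s)`.

## References

* [DavenportHeilbronn1936a] H. Davenport, H. Heilbronn, *On the zeros of certain Dirichlet series I*,
  J. London Math. Soc. 11 (1936), 181–185, §2 (definition of `a(p)`, Lemma 1) and §4.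
* [Titchmarsh1986] E. C. Titchmarsh, *The Theory of the Riemann Zeta-Function*, 2nd ed., §10.25.
-/

noncomputable section

open Complex NumberField IsDedekindDomain Module
open Literature.NumberTheory.LFunctions Literature.NumberTheory.LFunctions.AbelianDensity
open scoped nonZeroDivisors ComplexConjugate Classical

namespace Literature.Barriers.RiemannHypothesis

namespace DHEpstein

variable {K : Type*} [Field K] [NumberField K]

/-! ## Prime ideals of a quadratic field -/

omit [NumberField K] in
/-- The rational prime `p` below `𝔭` lies in `𝔭`. [folklore] -/
theorem natCast_underPrime_mem (v : HeightOneSpectrum (𝓞 K)) :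
    ((underPrime K v : ℕ) : 𝓞 K) ∈ v.asIdeal :=
  Int.absNorm_under_mem v.asIdeal

omit [NumberField K] in
/-- `(p) ≤ 𝔭` for the prime `p` below `𝔭`. [folklore] -/
theorem span_underPrime_le (v : HeightOneSpectrum (𝓞 K)) :
    Ideal.span {((underPrime K v : ℕ) : 𝓞 K)} ≤ v.asIdeal :=
  (Ideal.span_singleton_le_iff_mem _).2 (natCast_underPrime_mem v)

/-- `N((p)) = p^{[K:ℚ]}`.  DUPLICATE (dedup-00625) of
`Literature.NumberTheory.LFunctions.IdealNormCount.absNorm_span_natCast` (same statement, `K`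
explicit there), itself Mathlib's `Ideal.absNorm_span_natCast` with `RingOfIntegers.rank`; kept only
as a deprecated name — use `IdealNormCount.absNorm_span_natCast K p`. [folklore] -/
@[deprecated IdealNormCount.absNorm_span_natCast (since := "2026-08-15")]
theorem absNorm_span_natCast_eq (p : ℕ) :
    Ideal.absNorm (Ideal.span {((p : ℕ) : 𝓞 K)}) = p ^ finrank ℚ K :=
  IdealNormCount.absNorm_span_natCast K p

/-- An ideal contained in another ideal of the same (nonzero) norm equals it. [folklore] -/
theorem eq_of_le_of_absNorm_eq {I J : Ideal (𝓞 K)} (hle : J ≤ I) (hJ : J ≠ ⊥)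
    (h : Ideal.absNorm J = Ideal.absNorm I) : J = I := by
  obtain ⟨L, hL⟩ := Ideal.dvd_iff_le.2 hle
  have hI : I ≠ ⊥ := fun h0 ↦ hJ (le_bot_iff.1 (h0 ▸ hle))
  have hN : Ideal.absNorm I ≠ 0 := by rwa [Ne, Ideal.absNorm_eq_zero_iff]
  have h1 : Ideal.absNorm I * Ideal.absNorm L = Ideal.absNorm I * 1 := by
    rw [← map_mul, ← hL, h, mul_one]
  have hL1 : Ideal.absNorm L = 1 := mul_left_cancel₀ hN h1
  rw [Ideal.absNorm_eq_one_iff] at hL1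
  rw [hL, hL1, Ideal.mul_top]

/-- If `N𝔭` is a rational prime `p`, then `p` is the prime below `𝔭`. [folklore] -/
theorem underPrime_eq_of_absNorm_prime {v : HeightOneSpectrum (𝓞 K)} {p : ℕ} (hp : p.Prime)
    (hv : Ideal.absNorm v.asIdeal = p) : underPrime K v = p := by
  obtain ⟨f, hf0, hf⟩ := absNorm_eq_underPrime_pow K v
  rw [hv] at hf
  have hdvd : underPrime K v ∣ p := by rw [hf]; exact dvd_pow_self _ hf0.ne'
  exact (Nat.prime_dvd_prime_iff_eq (underPrime_prime K v) hp).1 hdvd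

/-- **In a quadratic field, `N𝔭 = p` or `N𝔭 = p²`** (`p` the prime below `𝔭`; fundamental identity
`∑ e f = 2`, here through `N𝔭 ∣ N((p)) = p²`). [folklore] -/
theorem absNorm_eq_or_eq_sq (h2 : finrank ℚ K = 2) (v : HeightOneSpectrum (𝓞 K)) :
    Ideal.absNorm v.asIdeal = underPrime K v ∨ Ideal.absNorm v.asIdeal = underPrime K v ^ 2 := by
  set p := underPrime K v with hp
  have hpp : p.Prime := underPrime_prime K v
  have hdvd : Ideal.absNorm v.asIdeal ∣ p ^ 2 := by
    have := Ideal.absNorm_dvd_absNorm_of_le (span_underPrime_le v)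
    rwa [IdealNormCount.absNorm_span_natCast, h2] at this
  obtain ⟨k, hk, hkeq⟩ := (Nat.dvd_prime_pow hpp).mp hdvd
  interval_cases k
  · exfalso
    rw [pow_zero, Ideal.absNorm_eq_one_iff] at hkeq
    exact v.isPrime.ne_top hkeq
  · left; rw [hkeq, pow_one]
  · right; exact hkeq

/-- **A prime of norm `p²` in a quadratic field is `(p)`**, hence principal. [folklore] -/
theorem asIdeal_eq_span_of_absNorm_eq_sq (h2 : finrank ℚ K = 2) {v : HeightOneSpectrum (𝓞 K)}
    (hv : Ideal.absNorm v.asIdeal = underPrime K v ^ 2) :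
    v.asIdeal = Ideal.span {((underPrime K v : ℕ) : 𝓞 K)} := by
  refine (eq_of_le_of_absNorm_eq (span_underPrime_le v) ?_ ?_).symm
  · rw [Ne, Ideal.span_singleton_eq_bot]
    exact_mod_cast (underPrime_prime K v).ne_zero
  · rw [IdealNormCount.absNorm_span_natCast, h2, hv]

/-- A prime of norm `p²` in a quadratic field has trivial class. [folklore] -/
theorem primeClass_eq_one_of_absNorm_eq_sq (h2 : finrank ℚ K = 2) {v : HeightOneSpectrum (𝓞 K)}
    (hv : Ideal.absNorm v.asIdeal = underPrime K v ^ 2) : primeClass v = 1 := by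
  rw [← idealClass_asIdeal, asIdeal_eq_span_of_absNorm_eq_sq h2 hv]
  exact idealClass_span_singleton (by exact_mod_cast (underPrime_prime K v).ne_zero)

/-- **Two distinct primes of the same prime norm `p` in a quadratic field multiply to `(p)`**
(D–H I §4: "the same `N𝔭` can arise only from two different `𝔭`'s, and the product `𝔭₁𝔭₂` of two
such `𝔭`'s is a rational prime"). [cite: DavenportHeilbronn1936a, §4] -/
theorem mul_eq_span_of_absNorm_eq (h2 : finrank ℚ K = 2) {v w : HeightOneSpectrum (𝓞 K)} (hvw : v ≠ w)
    {p : ℕ} (hp : p.Prime) (hv : Ideal.absNorm v.asIdeal = p) (hw : Ideal.absNorm w.asIdeal = p) :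
    v.asIdeal * w.asIdeal = Ideal.span {((p : ℕ) : 𝓞 K)} := by
  have hpv : underPrime K v = p := underPrime_eq_of_absNorm_prime hp hv
  have hpw : underPrime K w = p := underPrime_eq_of_absNorm_prime hp hw
  have hle_v : Ideal.span {((p : ℕ) : 𝓞 K)} ≤ v.asIdeal := hpv ▸ span_underPrime_le v
  have hle_w : Ideal.span {((p : ℕ) : 𝓞 K)} ≤ w.asIdeal := hpw ▸ span_underPrime_le w
  have hne : v.asIdeal ≠ w.asIdeal := fun h ↦ hvw (HeightOneSpectrum.ext h)
  have hmax_v : v.asIdeal.IsMaximal := v.isPrime.isMaximal v.ne_bot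
  have hmax_w : w.asIdeal.IsMaximal := w.isPrime.isMaximal w.ne_bot
  have hcop : v.asIdeal ⊔ w.asIdeal = ⊤ := hmax_v.coprime_of_ne hmax_w hne
  have hmul : v.asIdeal * w.asIdeal = v.asIdeal ⊓ w.asIdeal := Ideal.mul_eq_inf_of_coprime hcop
  have hle : Ideal.span {((p : ℕ) : 𝓞 K)} ≤ v.asIdeal * w.asIdeal := hmul ▸ le_inf hle_v hle_w
  refine (eq_of_le_of_absNorm_eq hle ?_ ?_).symm
  · rw [Ne, Ideal.span_singleton_eq_bot]
    exact_mod_cast hp.ne_zero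
  · rw [IdealNormCount.absNorm_span_natCast, h2, map_mul, hv, hw, sq]

/-- Two distinct primes of the same prime norm in a quadratic field have inverse classes.
[cite: DavenportHeilbronn1936a, §4] -/
theorem primeClass_mul_primeClass_eq_one (h2 : finrank ℚ K = 2) {v w : HeightOneSpectrum (𝓞 K)}
    (hvw : v ≠ w) {p : ℕ} (hp : p.Prime) (hv : Ideal.absNorm v.asIdeal = p)
    (hw : Ideal.absNorm w.asIdeal = p) : primeClass v * primeClass w = 1 := by
  rw [← idealClass_asIdeal, ← idealClass_asIdeal, ← idealClass_mul v.ne_bot w.ne_bot,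
    mul_eq_span_of_absNorm_eq h2 hvw hp hv hw]
  exact idealClass_span_singleton (by exact_mod_cast hp.ne_zero)

/-! ## Real characters of the class group -/

/-- A character of a finite group has unit-modulus values, so its conjugate is its inverse.
[folklore] -/
theorem conj_toMulHom (χ : AddChar (Additive (ClassGroup (𝓞 K))) ℂ) (g : ClassGroup (𝓞 K)) :
    conj (toMulHom χ g) = toMulHom (-χ) g := by
  rw [toMulHom_apply, toMulHom_apply, AddChar.neg_apply', ← Complex.inv_eq_conj (AddChar.norm_apply χ _)]

omit [NumberField K] in
/-- **Real characters**: `χ₁` is real when all its values are `±1`; then `χ₁ + χ₁ = 0`. [folklore] -/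
theorem add_self_eq_zero_of_real {χ₁ : AddChar (Additive (ClassGroup (𝓞 K))) ℂ}
    (hreal : ∀ g, toMulHom χ₁ g = 1 ∨ toMulHom χ₁ g = -1) : χ₁ + χ₁ = 0 := by
  ext x
  rw [AddChar.add_apply, AddChar.zero_apply]
  rcases hreal (Additive.toMul x) with h | h <;>
  · rw [toMulHom_apply, ofMul_toMul] at h
    rw [h]; norm_num

omit [NumberField K] in
/-- For a real character, `−χ₁ = χ₁`. [folklore] -/
theorem neg_eq_self_of_real {χ₁ : AddChar (Additive (ClassGroup (𝓞 K))) ℂ}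
    (hreal : ∀ g, toMulHom χ₁ g = 1 ∨ toMulHom χ₁ g = -1) : -χ₁ = χ₁ :=
  neg_eq_of_add_eq_zero_left (add_self_eq_zero_of_real hreal)

omit [NumberField K] in
/-- For a real character, `χ₁(g)⁻¹ = χ₁(g)` and `χ₁(g)² = 1`. [folklore] -/
theorem toMulHom_mul_self_of_real {χ₁ : AddChar (Additive (ClassGroup (𝓞 K))) ℂ}
    (hreal : ∀ g, toMulHom χ₁ g = 1 ∨ toMulHom χ₁ g = -1) (g : ClassGroup (𝓞 K)) :
    toMulHom χ₁ g * toMulHom χ₁ g = 1 := by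
  rcases hreal g with h | h <;> rw [h] <;> norm_num

/-! ## The genus twist `a` of Davenport–Heilbronn I -/

/-! The prime values of Davenport–Heilbronn's twist (I §2/§4): a completely multiplicative
`a : ℕ →* ℂ` is a *genus twist* for the real character `χ₁` of `Cl(K)` when `a(p) = i` if
`χ₁([𝔭]) = −1` for some prime `𝔭` of norm `p`, and `a(p) = 1` for all other primes `p` — throughout
a HYPOTHESIS `ha` on `a` (the sibling assembly realises it with the tree's `complMul`). -/

/-- `1 ≠ i`. [folklore] -/
theorem one_ne_I : (1 : ℂ) ≠ I := fun h ↦ by simpa using congrArg Complex.im h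

/-- The values `a(p) ∈ {1, i}` of a genus twist. [folklore] -/
theorem IsDHGenusTwist.apply_prime_eq {χ₁ : AddChar (Additive (ClassGroup (𝓞 K))) ℂ} {a : ℕ →* ℂ}
    (ha : ∀ p : ℕ, p.Prime → a p = if (∃ v : HeightOneSpectrum (𝓞 K),
      Ideal.absNorm v.asIdeal = p ∧ toMulHom χ₁ (primeClass v) = -1) then I else 1)
    {p : ℕ} (hp : p.Prime) : a p = 1 ∨ a p = I := by
  rw [ha p hp]
  split_ifs
  · exact Or.inr rfl
  · exact Or.inl rfl

/-- `|a(p)| = 1` at the primes. [folklore] -/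
theorem IsDHGenusTwist.norm_apply_prime {χ₁ : AddChar (Additive (ClassGroup (𝓞 K))) ℂ} {a : ℕ →* ℂ}
    (ha : ∀ p : ℕ, p.Prime → a p = if (∃ v : HeightOneSpectrum (𝓞 K),
      Ideal.absNorm v.asIdeal = p ∧ toMulHom χ₁ (primeClass v) = -1) then I else 1) :
    ∀ p : ℕ, p.Prime → ‖a p‖ = 1 := fun p hp ↦ by
  rcases IsDHGenusTwist.apply_prime_eq ha hp with h | h <;> rw [h] <;> simp

/-- **Well-definedness of the twist** ("`a(𝔭₁) = a(𝔭₂)`"): in a quadratic field, for EVERY prime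
`𝔭` of prime norm `p`, `a(p) = i ↔ χ₁([𝔭]) = −1`. (If `χ₁([𝔭']) = −1` for another prime `𝔭'` of norm
`p` then `𝔭𝔭' = (p)`, so `χ₁([𝔭])χ₁([𝔭']) = 1` and `χ₁([𝔭]) = −1` as well.)
[cite: DavenportHeilbronn1936a, §4] -/
theorem IsDHGenusTwist.apply_eq_I_iff (h2 : finrank ℚ K = 2)
    {χ₁ : AddChar (Additive (ClassGroup (𝓞 K))) ℂ}
    (hreal : ∀ g, toMulHom χ₁ g = 1 ∨ toMulHom χ₁ g = -1) {a : ℕ →* ℂ}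
    (ha : ∀ p : ℕ, p.Prime → a p = if (∃ v : HeightOneSpectrum (𝓞 K),
      Ideal.absNorm v.asIdeal = p ∧ toMulHom χ₁ (primeClass v) = -1) then I else 1)
    {w : HeightOneSpectrum (𝓞 K)} {p : ℕ} (hp : p.Prime) (hw : Ideal.absNorm w.asIdeal = p) :
    a p = I ↔ toMulHom χ₁ (primeClass w) = -1 := by
  rw [ha p hp]
  constructor
  · intro h
    by_contra hne
    have hex : ∃ v : HeightOneSpectrum (𝓞 K), Ideal.absNorm v.asIdeal = p ∧ toMulHom χ₁ (primeClass v) = -1 := by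
      by_contra hno
      rw [if_neg hno] at h
      exact one_ne_I h
    obtain ⟨v, hv, hv1⟩ := hex
    have hvw : v ≠ w := fun h' ↦ hne (h' ▸ hv1)
    have hprod := primeClass_mul_primeClass_eq_one h2 hvw hp hv hw
    have h1 : toMulHom χ₁ (primeClass v) * toMulHom χ₁ (primeClass w) = 1 := by
      rw [← map_mul, hprod, map_one]
    rw [hv1] at h1
    rcases hreal (primeClass w) with h' | h'
    · rw [h'] at h1; norm_num at h1
    · exact hne h'
  · intro h
    rw [if_pos ⟨w, hw, h⟩]

/-- **The values of the twist on degree-one primes**: for a prime `𝔭` of prime norm `p`,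
`a(N𝔭) = ½(1+i) + ½(1−i)χ₁([𝔭])` (D–H I §2, proof of Lemma 1:
"`= ½∑{1 + χ₁(p)}χ(p)p^{-s} + ½i∑{1 − χ₁(p)}χ(p)p^{-s}`"). [cite: DavenportHeilbronn1936a, §2 Lemma 1] -/
theorem IsDHGenusTwist.apply_absNorm_eq_of_prime (h2 : finrank ℚ K = 2)
    {χ₁ : AddChar (Additive (ClassGroup (𝓞 K))) ℂ}
    (hreal : ∀ g, toMulHom χ₁ g = 1 ∨ toMulHom χ₁ g = -1) {a : ℕ →* ℂ}
    (ha : ∀ p : ℕ, p.Prime → a p = if (∃ v : HeightOneSpectrum (𝓞 K),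
      Ideal.absNorm v.asIdeal = p ∧ toMulHom χ₁ (primeClass v) = -1) then I else 1)
    {w : HeightOneSpectrum (𝓞 K)} (hw : (Ideal.absNorm w.asIdeal).Prime) :
    a (Ideal.absNorm w.asIdeal) =
      (1 + I) / 2 + (1 - I) / 2 * toMulHom χ₁ (primeClass w) := by
  have hiff := IsDHGenusTwist.apply_eq_I_iff h2 hreal ha (w := w) hw rfl
  rcases hreal (primeClass w) with h | h
  · rw [h]
    have : a (Ideal.absNorm w.asIdeal) ≠ I := fun h' ↦ by
      have := hiff.1 h'; rw [h] at this; norm_num at this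
    rcases IsDHGenusTwist.apply_prime_eq ha hw with h1 | h1
    · rw [h1]; ring
    · exact absurd h1 this
  · rw [h, hiff.2 h]; ring

/-- **`conj a(N𝔭) = χ₁([𝔭]) a(N𝔭)` for every prime `𝔭` of a quadratic field** (degree one:
`a ∈ {1, i}` with `a = i ↔ χ₁ = −1`; degree two: `𝔭 = (p)` is principal, `χ₁([𝔭]) = 1`, and
`a(p²) = a(p)² ∈ {1, −1}` is real). [cite: DavenportHeilbronn1936a, §2 and §4] -/
theorem IsDHGenusTwist.conj_apply_absNorm (h2 : finrank ℚ K = 2)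
    {χ₁ : AddChar (Additive (ClassGroup (𝓞 K))) ℂ}
    (hreal : ∀ g, toMulHom χ₁ g = 1 ∨ toMulHom χ₁ g = -1) {a : ℕ →* ℂ}
    (ha : ∀ p : ℕ, p.Prime → a p = if (∃ v : HeightOneSpectrum (𝓞 K),
      Ideal.absNorm v.asIdeal = p ∧ toMulHom χ₁ (primeClass v) = -1) then I else 1)
    (w : HeightOneSpectrum (𝓞 K)) :
    conj (a (Ideal.absNorm w.asIdeal)) = toMulHom χ₁ (primeClass w) * a (Ideal.absNorm w.asIdeal) := by
  have hpp : (underPrime K w).Prime := underPrime_prime K w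
  rcases absNorm_eq_or_eq_sq h2 w with hN | hN
  · -- degree one
    have hw : (Ideal.absNorm w.asIdeal).Prime := hN ▸ hpp
    rw [IsDHGenusTwist.apply_absNorm_eq_of_prime h2 hreal ha hw]
    rcases hreal (primeClass w) with h | h <;> rw [h]
    · have e : (1 + I) / 2 + (1 - I) / 2 * 1 = (1 : ℂ) := by ring
      rw [e, map_one, one_mul]
    · have e : (1 + I) / 2 + (1 - I) / 2 * (-1) = I := by ring
      rw [e, Complex.conj_I]
      ring
  · -- degree two: `w = (p)` principal, `a(p²) = a(p)²` real
    rw [primeClass_eq_one_of_absNorm_eq_sq h2 hN, map_one, one_mul, hN, map_pow]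
    rcases IsDHGenusTwist.apply_prime_eq ha hpp with h | h <;> rw [h]
    · simp
    · rw [map_pow, Complex.conj_I]
      ring

/-- **The conjugation symmetry of the twisted coefficients**: `conj (χ([𝔭]) a(N𝔭)) =
(χ₁ − χ)([𝔭]) a(N𝔭)` for every prime `𝔭`, i.e. `conj ∘ twistCoeff χ a = twistCoeff (χ₁ − χ) a`
("`M(s, χ₀)` and `M(s, χ₁)` are conjugate for real `s`", Titchmarsh §10.25; D–H I §2: "`Z(s)` is real
for `s > 1`"). [cite: DavenportHeilbronn1936a, §2] [cite: Titchmarsh1986, §10.25] -/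
theorem IsDHGenusTwist.conj_twistCoeff (h2 : finrank ℚ K = 2)
    {χ₁ : AddChar (Additive (ClassGroup (𝓞 K))) ℂ}
    (hreal : ∀ g, toMulHom χ₁ g = 1 ∨ toMulHom χ₁ g = -1) {a : ℕ →* ℂ}
    (ha : ∀ p : ℕ, p.Prime → a p = if (∃ v : HeightOneSpectrum (𝓞 K),
      Ideal.absNorm v.asIdeal = p ∧ toMulHom χ₁ (primeClass v) = -1) then I else 1)
    (χ : AddChar (Additive (ClassGroup (𝓞 K))) ℂ) (w : HeightOneSpectrum (𝓞 K)) :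
    conj (twistCoeff χ a w) = twistCoeff (χ₁ - χ) a w := by
  unfold twistCoeff
  rw [map_mul, IsDHGenusTwist.conj_apply_absNorm h2 hreal ha w, conj_toMulHom, ← mul_assoc]
  congr 1
  rw [toMulHom_apply, toMulHom_apply, toMulHom_apply, AddChar.sub_apply, AddChar.neg_apply, mul_comm]

end DHEpstein

end Literature.Barriers.RiemannHypothesis
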